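import Summits.AnomalousDissipation.AnomalousDissipation.Theses.TwoAndHalfD
import Literature.Analysis.FluidPDE.PassiveScalarForced
import Mathlib

/-!
# Sketch (crux-ideate r1, ideator 3) for crux `TwoAndHalfD.TwohalfdThesis`
# (stmt-AnomalousDissipation-0206) — first lemmas of the idea cards

* Card A `eternal-from-transients`: `survivor_of_longTransients` (PROVED, abstract Cantor
  intersection) + the typed transfer chain `UniformLoudTransients → LoudSurvivorFamily`
  (`EternalFromTransients`, the card's first crux-sized lemma) and
  `LoudSurvivorFamily → TwohalfdThesis` (`SurvivorLift`, M: windows ⇒ limsup means + 2½-D lift).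
* Card B `torque-slaved-source`: `TorqueComparison` (parabolic comparison of the two `Pr = 1`
  scalars on a sign-definite torque region; provable by the weak maximum principle) and the
  design lemmas `SmoothOfTorque`, `zeroMean_of_oddTorque`.

Statements only elaborate (`def … : Prop`), except the proved abstract lemma.
-/

noncomputable section

set_option linter.dupNamespace false

open scoped BigOperators Topology InnerProductSpace
open Filter Set Function MeasureTheory

namespace Summit.AnomalousDissipation.AnomalousDissipation.Cruxes.TwohalfdThesis.SketchIdeator3

open Literature.Analysis
open Literature.Analysis.FunctionSpaces Literature.Analysis.FunctionSpaces.Torus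
open Literature.Analysis.FluidPDE Literature.Analysis.FluidPDE.Torus
open Summit.AnomalousDissipation.AnomalousDissipation.Theses.TwoAndHalfD

/-- The flat two-torus. -/
local notation "𝕋²" => UnitAddTorus (Fin 2)
/-- Planar velocity values. -/
local notation "E²" => EuclideanSpace ℝ (Fin 2)

/-! ## Card A — eternity by compactness (survivor sets) -/

/-- **Survivor principle (abstract Cantor intersection).** If a continuous self-map has, for every
`n`, an orbit segment of length `n` starting in a compact set `K` and staying in a closed set `G`,
then it has an orbit starting in `K` that stays in `G` forever.  No hyperbolicity, no invariant
measure, no periodic orbit is needed: nested compact non-empty sets. -/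
theorem survivor_of_longTransients {X : Type*} [TopologicalSpace X] [T2Space X]
    {K G : Set X} (hK : IsCompact K) (hG : IsClosed G) (Φ : X → X) (hΦ : Continuous Φ)
    (h : ∀ n : ℕ, ∃ x ∈ K, ∀ k ≤ n, Φ^[k] x ∈ G) :
    ∃ x ∈ K, ∀ k : ℕ, Φ^[k] x ∈ G := by
  -- the nested sets `A n = K ∩ {x | the first n+1 iterates stay in G}`
  let A : ℕ → Set X := fun n => K ∩ {x | ∀ k ≤ n, Φ^[k] x ∈ G}
  have hGk : ∀ k : ℕ, IsClosed ((Φ^[k]) ⁻¹' G) := fun k => hG.preimage (hΦ.iterate k)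
  have hcl : ∀ n, IsClosed {x : X | ∀ k ≤ n, Φ^[k] x ∈ G} := by
    intro n
    have : {x : X | ∀ k ≤ n, Φ^[k] x ∈ G} = ⋂ k ∈ {k : ℕ | k ≤ n}, (Φ^[k]) ⁻¹' G := by
      ext x; simp
    rw [this]
    exact isClosed_biInter fun k _ => hGk k
  have hAcl : ∀ n, IsClosed (A n) := fun n => hK.isClosed.inter (hcl n)
  have hA0 : IsCompact (A 0) := hK.inter_right (hcl 0)
  have hmono : ∀ n, A (n + 1) ⊆ A n := by
    intro n x hx
    exact ⟨hx.1, fun k hk => hx.2 k (Nat.le_succ_of_le hk)⟩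
  have hne : ∀ n, (A n).Nonempty := by
    intro n
    obtain ⟨x, hxK, hx⟩ := h n
    exact ⟨x, hxK, hx⟩
  obtain ⟨x, hx⟩ :=
    IsCompact.nonempty_iInter_of_sequence_nonempty_isCompact_isClosed A hmono hne hA0 hAcl
  rw [Set.mem_iInter] at hx
  refine ⟨x, (hx 0).1, fun k => ?_⟩
  exact (hx k).2 k le_rfl

/-- Windowed loudness of a classical 2½-D pair `(v, θ)` on the window `[kτ, (k+1)τ]`: window-mean
of `2·kineticEnergy v + ‖θ‖²` at most `E` and window-mean of `ν(‖∇v‖² + ‖∇θ‖²)` at least `ε`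
(pointwise norms of smooth slices; no `limsup`, no `toReal` junk). -/
def LoudWindow (ν E ε τ : ℝ) (v : ℝ → 𝕋² → E²) (θ : ℝ → 𝕋² → ℝ) (k : ℕ) : Prop :=
  τ⁻¹ * (∫ t in ((k : ℝ) * τ)..(((k : ℝ) + 1) * τ), (2 * kineticEnergy (v t) + scalarL2Sq (θ t))) ≤ E ∧
  ε ≤ τ⁻¹ * ∫ t in ((k : ℝ) * τ)..(((k : ℝ) + 1) * τ), ν * (gradNormSq (v t) + scalarGradNormSq (θ t))

/-- **C⁺ of card A (the residual, per-ν and finite-horizon).** One steady smooth admissible pair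
`(g, h)`, thresholds `E, ε, τ`, a viscosity ladder `ν_j → 0`, and FOR EVERY `j` AND EVERY HORIZON `n`
some classical 2-D Navier–Stokes solution `v` (force `g`, any smooth data) with its classical sourced
scalar `θ` (source `h`, any smooth data, `Pr = 1`) loud on each of the first `n` windows.  The data
may depend on `n`; nothing is asked beyond time `nτ`. -/
def UniformLoudTransients : Prop :=
  ∃ (g : 𝕋² → E²) (h : 𝕋² → ℝ), IsSmooth g ∧ IsDivFree g ∧ HasZeroMean g ∧ IsSmooth h ∧
    HasZeroMean h ∧ ∃ (E ε τ : ℝ), 0 < ε ∧ 0 < τ ∧ ∃ ν : ℕ → ℝ, (∀ j, 0 < ν j) ∧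
    Tendsto ν atTop (𝓝 0) ∧
    ∀ (j n : ℕ), ∃ (v : ℝ → 𝕋² → E²) (p : ℝ → 𝕋² → ℝ) (θ : ℝ → 𝕋² → ℝ),
      IsClassicalNSSolutionOn (Set.Ici 0) (ν j) (fun _ => g) v p ∧
      IsClassicalScalarTransportForcedOn (Set.Ici 0) (ν j) v (fun _ => h) θ ∧
      ∀ k : ℕ, k < n → LoudWindow (ν j) E ε τ v θ k

/-- **Eternal version** (what the survivor principle produces): the same, with ONE trajectory per
`j` loud on every window. -/
def LoudSurvivorFamily : Prop :=
  ∃ (g : 𝕋² → E²) (h : 𝕋² → ℝ), IsSmooth g ∧ IsDivFree g ∧ HasZeroMean g ∧ IsSmooth h ∧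
    HasZeroMean h ∧ ∃ (E ε τ : ℝ), 0 < ε ∧ 0 < τ ∧ ∃ ν : ℕ → ℝ, (∀ j, 0 < ν j) ∧
    Tendsto ν atTop (𝓝 0) ∧
    ∀ j : ℕ, ∃ (v : ℝ → 𝕋² → E²) (p : ℝ → 𝕋² → ℝ) (θ : ℝ → 𝕋² → ℝ),
      IsClassicalNSSolutionOn (Set.Ici 0) (ν j) (fun _ => g) v p ∧
      IsClassicalScalarTransportForcedOn (Set.Ici 0) (ν j) v (fun _ => h) θ ∧
      ∀ k : ℕ, LoudWindow (ν j) E ε τ v θ k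

/-- **First lemma of card A (typed; size L).** Eternity is free in 2½-D: at fixed `ν > 0` the
time-`τ` map of (2-D NS, sourced scalar) is continuous and compact on `L² × L²` and the set of
states whose next window is loud is closed in the `H¹ × H¹`-compact image `Φ_τ(ball)`, so
`survivor_of_longTransients` applies at each `j` (thresholds `E, ε, τ` are `j`-uniform by
hypothesis; nothing else needs to be uniform). -/
def EternalFromTransients : Prop :=
  UniformLoudTransients → LoudSurvivorFamily

/-- **Glue of card A (typed; size M).** Loud windows for all `k` ⇒ `limsup` Cesàro means obey the
same bounds (`meanEnergy ≤ E`, `meanDissipation ≥ ε`, honest: bounded classical integrands); the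
classical pair lifts to an `x₃`-invariant global Leray–Hopf solution `twoHalf v θ` with force
`twoHalf g h` (`Torus.isClassicalNSSolutionOn_twoHalf` + classical ⇒ Leray–Hopf, both in tree). -/
def SurvivorLift : Prop :=
  LoudSurvivorFamily → TwohalfdThesis

/-- The chain of card A concludes the crux BY NAME (kernel-checked composition). -/
theorem cardA_chain (h₁ : EternalFromTransients) (h₂ : SurvivorLift) :
    UniformLoudTransients → TwohalfdThesis :=
  fun h => h₂ (h₁ h)

/-! ## Card B — torque-slaved source and the Pr = 1 comparison principle -/

/-- **First lemma of card B (typed; provable by the weak parabolic maximum principle).**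
Two classical sourced scalars in the SAME drift with the SAME diffusivity (`Pr = 1`: vorticity
`θ_G`, source `G = curl g`; passive third component `θ_h`, source `h`).  On a space–time cylinder
`[t₀,t₁] × D` on which the source is dominated by the torque in RATIO, `|h| ≤ K·G` pointwise
(so `G ≥ 0` there; `K = 0` where `h` vanishes identically, `K = sup|F(s)/s|` for a torque-slaved
`h = F ∘ G` on `{G > 0}`), the scalar is slaved to the vorticity up to parabolic-boundary data:
`|θ_h| ≤ W + K (θ_G + M)` on the cylinder.  Proof: `K(θ_G + M) + W ∓ θ_h` are supersolutions
(`L = ∂ₜ + u·∇ − κΔ` gives `K G ∓ h ≥ 0`), nonnegative on the parabolic boundary.  With `K = 0`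
(source flat-zero on strong torque) it is the bare maximum principle: no pile-up of `θ_h` in ANY
strong-torque trap, pinned or not. -/
def TorqueComparison : Prop :=
  ∀ (κ t₀ t₁ : ℝ) (u : ℝ → 𝕋² → E²) (sG sh θG θh : ℝ → 𝕋² → ℝ) (D : Set 𝕋²) (K M W : ℝ),
    0 < κ → t₀ < t₁ → IsOpen D → 0 ≤ K →
    IsClassicalScalarTransportForcedOn (Set.Icc t₀ t₁) κ u sG θG →
    IsClassicalScalarTransportForcedOn (Set.Icc t₀ t₁) κ u sh θh →
    (∀ t ∈ Set.Icc t₀ t₁, ∀ x ∈ D, |sh t x| ≤ K * sG t x) →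
    (∀ x ∈ closure D, -M ≤ θG t₀ x ∧ |θh t₀ x| ≤ W) →
    (∀ t ∈ Set.Icc t₀ t₁, ∀ x ∈ frontier D, -M ≤ θG t x ∧ |θh t x| ≤ W) →
    ∀ t ∈ Set.Icc t₀ t₁, ∀ x ∈ D, |θh t x| ≤ W + K * (θG t x + M)

/-- **Corollary shape (typed): bare maximum principle where the source vanishes.** The `K = 0`
instance, stated on its own because it is what kills trap pile-up: if `h ≡ 0` on the cylinder then
`|θ_h|` is bounded by its parabolic-boundary values. -/
def SourceFreeMaxPrinciple : Prop :=
  ∀ (κ t₀ t₁ : ℝ) (u : ℝ → 𝕋² → E²) (sh θh : ℝ → 𝕋² → ℝ) (D : Set 𝕋²) (W : ℝ),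
    0 < κ → t₀ < t₁ → IsOpen D →
    IsClassicalScalarTransportForcedOn (Set.Icc t₀ t₁) κ u sh θh →
    (∀ t ∈ Set.Icc t₀ t₁, ∀ x ∈ D, sh t x = 0) →
    (∀ x ∈ closure D, |θh t₀ x| ≤ W) →
    (∀ t ∈ Set.Icc t₀ t₁, ∀ x ∈ frontier D, |θh t x| ≤ W) →
    ∀ t ∈ Set.Icc t₀ t₁, ∀ x ∈ D, |θh t x| ≤ W

/-- **Design lemma B1 (typed; routine).** A torque-slaved source `h = F ∘ G` is smooth when the
profile `F : ℝ → ℝ` and the torque `G` are. -/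
def SmoothOfTorque : Prop :=
  ∀ (F : ℝ → ℝ) (G : 𝕋² → ℝ), ContDiff ℝ (⊤ : ℕ∞) F → IsSmooth G → IsSmooth (F ∘ G)

/-- **Design lemma B2 (typed; routine).** If the torque is odd under a translation of the torus
(`G (x + c) = -G x`, e.g. `c = (½,½)` for `G = A(cos 2πx₁ + cos 2πx₂) + B(cos 2πbx₁ + cos 2πbx₂)`
with `b` odd) and the profile `F` is odd, then `h = F ∘ G` has zero mean (translation invariance of
Haar measure), so `(g, h)` is an admissible steady force pair for the crux. -/
def ZeroMeanOfOddTorque : Prop :=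
  ∀ (F : ℝ → ℝ) (G : 𝕋² → ℝ) (c : 𝕋²), (∀ s, F (-s) = -F s) → Continuous F → Continuous G →
    (∀ x, G (x + c) = -G x) → HasZeroMean (F ∘ G)

/-- `SmoothOfTorque` holds (composition of `C^∞` maps through the periodic lift). -/
theorem smoothOfTorque_holds : SmoothOfTorque := by
  intro F G hF hG
  -- `lift (F ∘ G) = F ∘ lift G` definitionally
  exact hF.comp hG

/-- `ZeroMeanOfOddTorque` holds (translation invariance of Haar measure on `T²` and oddness). -/
theorem zeroMeanOfOddTorque_holds : ZeroMeanOfOddTorque := by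
  intro F G c hF _hFc _hGc hG
  unfold HasZeroMean
  have h1 : ∫ x, (F ∘ G) (x + c) = ∫ x, (F ∘ G) x :=
    integral_add_right_eq_self (fun x => (F ∘ G) x) c
  have h2 : ∫ x, (F ∘ G) (x + c) = -∫ x, (F ∘ G) x := by
    rw [← integral_neg]
    refine integral_congr_ae (Filter.Eventually.of_forall fun x => ?_)
    simp [Function.comp, hG x, hF]
  linarith

end Summit.AnomalousDissipation.AnomalousDissipation.Cruxes.TwohalfdThesis.SketchIdeator3
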